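import Summits.KontsevichZagierPeriods.KontsevichZagierPeriods.Theorems.HurwitzMicroSectorsNormalFormPrincipleM4WeightFourMZVFromLevelTwo
import Summits.KontsevichZagierPeriods.KontsevichZagierPeriods.Theorems.HurwitzMicroSectorsNormalFormPrincipleM4SharedTools
import Summits.KontsevichZagierPeriods.KontsevichZagierPeriods.Theorems.HurwitzMicroSectorsNormalFormPrincipleM4ExistsWordRep4
import Summits.KontsevichZagierPeriods.KontsevichZagierPeriods.Theorems.HurwitzMicroSectorsNormalFormPrincipleM4BoxSubSimplex4
import Summits.KontsevichZagierPeriods.KontsevichZagierPeriods.Theorems.HurwitzMicroSectorsNormalFormPrincipleM4LogTimesNegZetaThree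
import Summits.KontsevichZagierPeriods.KontsevichZagierPeriods.Theorems.HurwitzMicroSectorsNormalFormPrincipleL2W3Carriers
import Summits.KontsevichZagierPeriods.KontsevichZagierPeriods.Theorems.HyperbolicBlochOffTetraSectorKernelStubAffineOrbit
import Literature.NumberTheory.Transcendental.KZSubcalculusInvariants

/-!
# `NormalFormPrinciple` (stmt-KontsevichZagierPeriods-3869), line `SketchIdeator1` —
# leaf `stub_boxRigidity`, layer `M4`: three LEVEL-ONE box pairs closed through level two

Pure proof file (lead seat c9; `--supports` the crux). Three equal-value pairs of RATIONAL
four-dimensional boxes of the census (`Cruxes/NormalFormPrinciple/Lines/SketchIdeator1-leaf-m3.md`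
§5–6, tagged NEEDS-STUFFLE there), each settled by a chain of Kontsevich–Zagier moves that DESCENDS
THROUGH LEVEL TWO (`m4_weightFour_mzv_levelTwo`: distribution + shuffle + stuffle, no regularisation):

* `4·[□⁴, 1/((1 − x₀x₁x₂)(1 − x₀x₁x₂x₃))] ∼ 5·[□⁴, 1/(1 − x₀x₁x₂x₃)]`       (`ζ(3,1) + ζ(4) = (5/4)ζ(4)`),
* `7·[□⁴, 1/(1 − x₀x₁x₂x₃)] ∼ 4·[□⁴, 1/((1 − x₀x₁)(1 − x₀x₁x₂x₃))]`         (`ζ(2,2) + ζ(4) = (7/4)ζ(4)`),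
* `2·[□⁴, 1/((1 − x₀x₁)(1 − x₂x₃))] ∼ 5·[□⁴, 1/(1 − x₀x₁x₂x₃)]`             (`ζ(2)² = (5/2)ζ(4)`).

The sides chart onto words of `Δ₄` by the cubical chart (`m4_box_sub_simplex4`); the third left
side is the product `[□², 2/(1−xy)] × [□², 1/(1−zw)]` (congruence `m4b_of_sub_of_prod_mem_relations`,
product ideal, and the dimension-two chart `bss_box_sub_simplex_of_one_le` onto the word `ab`).
References: M. Kontsevich, D. Zagier, *Periods* (2001), §1.2 rules (1), (2), §4.1; D. Borwein,
J. Borwein, R. Girgensohn, Proc. Edinburgh Math. Soc. 38 (1995). No definitions are introduced.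
-/

noncomputable section

open MeasureTheory Set
open Literature.NumberTheory.Transcendental Literature.NumberTheory.Transcendental.KZ
open Literature.ModelTheory.ExponentialFields (IsSemialgebraic)
open Summit.KontsevichZagierPeriods.HyperbolicBloch.OffTetraSectorKernel
  (aff_orbit_of_sub_sum_zsmul_mem_relations)
open Summit.KontsevichZagierPeriods.HurwitzMicroSectors.NormalFormPrinciple.PiBox.Dilog
  (exists_dilogBox bss_box_sub_simplex_of_one_le)

namespace Summit.KontsevichZagierPeriods.HurwitzMicroSectors.NormalFormPrinciple.PiBox.M3

/-- **Carriers and the three level-one consequences of level two.** There exist word carriers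
`AB` on `Δ₂` and `AAAB, AABB, ABAB` on `Δ₄` with `4[aabb] − [aaab]`, `4[abab] − 3[aaab]`,
`2[ab]·[ab] − 5[aaab] ∈ KZ.relations` (`m4_weightFour_mzv_levelTwo` fed with carriers from
`m4t_exists_wordRep2`, `l2w3_carriers`, `m4_exists_wordRep4`). [cite: KontsevichZagier2001, §1.2] -/
theorem m4z_exists_carriers :
    ∃ (AB : IntegralRep 2) (AAAB AABB ABAB : IntegralRep 4),
      AB.domain = {t | 0 < t 1 ∧ t 1 < t 0 ∧ t 0 < 1} ∧ (AB.integrand = fun t => 1 / t 0 * (1 / (1 - t 1))) ∧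
      AAAB.domain = {t | 0 < t 3 ∧ t 3 < t 2 ∧ t 2 < t 1 ∧ t 1 < t 0 ∧ t 0 < 1} ∧
      (AAAB.integrand = fun t => 1 / t 0 * (1 / t 1) * (1 / t 2) * (1 / (1 - t 3))) ∧
      AABB.domain = {t | 0 < t 3 ∧ t 3 < t 2 ∧ t 2 < t 1 ∧ t 1 < t 0 ∧ t 0 < 1} ∧
      (AABB.integrand = fun t => 1 / t 0 * (1 / t 1) * (1 / (1 - t 2)) * (1 / (1 - t 3))) ∧
      ABAB.domain = {t | 0 < t 3 ∧ t 3 < t 2 ∧ t 2 < t 1 ∧ t 1 < t 0 ∧ t 0 < 1} ∧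
      (ABAB.integrand = fun t => 1 / t 0 * (1 / (1 - t 1)) * (1 / t 2) * (1 / (1 - t 3))) ∧
      ((4:ℤ) • of AABB - of AAAB ∈ relations) ∧
      ((4:ℤ) • of ABAB - (3:ℤ) • of AAAB ∈ relations) ∧
      ((2:ℤ) • of (AB.prod AB) - (5:ℤ) • of AAAB ∈ relations) := by
  obtain ⟨C1, hC1d, hC1i⟩ := m4b_exists_logBox
  obtain ⟨AB, hABd, hABi⟩ : ∃ T : IntegralRep 2, T.domain = {t | 0 < t 1 ∧ t 1 < t 0 ∧ t 0 < 1} ∧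
      (T.integrand = fun t => 1 / t 0 * (1 / (1 - t 1))) :=
    m4t_exists_wordRep2 (fun u => 1 / u) (fun u => 1 / (1 - u)) (Or.inl rfl) (Or.inl rfl)
  obtain ⟨AC, hACd, hACi⟩ : ∃ T : IntegralRep 2, T.domain = {t | 0 < t 1 ∧ t 1 < t 0 ∧ t 0 < 1} ∧
      (T.integrand = fun t => 1 / t 0 * (1 / (1 + t 1))) :=
    m4t_exists_wordRep2 (fun u => 1 / u) (fun u => 1 / (1 + u)) (Or.inl rfl) (Or.inr rfl)
  obtain ⟨AAB, -, AAC, -, -, -, -, -, -, -, -, -, -, -, -, -, ⟨hAABd, hAABi⟩, -, ⟨hAACd, hAACi⟩, -⟩ :=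
    l2w3_carriers
  obtain ⟨AAAB, hAAABd, hAAABi⟩ : ∃ T : IntegralRep 4, T.domain = {t | 0 < t 3 ∧ t 3 < t 2 ∧ t 2 < t 1 ∧ t 1 < t 0 ∧ t 0 < 1} ∧
      (T.integrand = fun t => 1 / t 0 * (1 / t 1) * (1 / t 2) * (1 / (1 - t 3))) :=
    m4_exists_wordRep4 (fun u => 1 / u) (fun u => 1 / u) (fun u => 1 / u) (fun u => 1 / (1 - u)) (Or.inl rfl) (Or.inl rfl) (Or.inl rfl) (Or.inl rfl)
  obtain ⟨AAAC, hAAACd, hAAACi⟩ : ∃ T : IntegralRep 4, T.domain = {t | 0 < t 3 ∧ t 3 < t 2 ∧ t 2 < t 1 ∧ t 1 < t 0 ∧ t 0 < 1} ∧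
      (T.integrand = fun t => 1 / t 0 * (1 / t 1) * (1 / t 2) * (1 / (1 + t 3))) :=
    m4_exists_wordRep4 (fun u => 1 / u) (fun u => 1 / u) (fun u => 1 / u) (fun u => 1 / (1 + u)) (Or.inl rfl) (Or.inl rfl) (Or.inl rfl) (Or.inr rfl)
  obtain ⟨AABB, hAABBd, hAABBi⟩ : ∃ T : IntegralRep 4, T.domain = {t | 0 < t 3 ∧ t 3 < t 2 ∧ t 2 < t 1 ∧ t 1 < t 0 ∧ t 0 < 1} ∧
      (T.integrand = fun t => 1 / t 0 * (1 / t 1) * (1 / (1 - t 2)) * (1 / (1 - t 3))) :=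
    m4_exists_wordRep4 (fun u => 1 / u) (fun u => 1 / u) (fun u => 1 / (1 - u)) (fun u => 1 / (1 - u)) (Or.inl rfl) (Or.inl rfl) (Or.inr (Or.inl rfl)) (Or.inl rfl)
  obtain ⟨AABC, hAABCd, hAABCi⟩ : ∃ T : IntegralRep 4, T.domain = {t | 0 < t 3 ∧ t 3 < t 2 ∧ t 2 < t 1 ∧ t 1 < t 0 ∧ t 0 < 1} ∧
      (T.integrand = fun t => 1 / t 0 * (1 / t 1) * (1 / (1 - t 2)) * (1 / (1 + t 3))) :=
    m4_exists_wordRep4 (fun u => 1 / u) (fun u => 1 / u) (fun u => 1 / (1 - u)) (fun u => 1 / (1 + u)) (Or.inl rfl) (Or.inl rfl) (Or.inr (Or.inl rfl)) (Or.inr rfl)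
  obtain ⟨AACB, hAACBd, hAACBi⟩ : ∃ T : IntegralRep 4, T.domain = {t | 0 < t 3 ∧ t 3 < t 2 ∧ t 2 < t 1 ∧ t 1 < t 0 ∧ t 0 < 1} ∧
      (T.integrand = fun t => 1 / t 0 * (1 / t 1) * (1 / (1 + t 2)) * (1 / (1 - t 3))) :=
    m4_exists_wordRep4 (fun u => 1 / u) (fun u => 1 / u) (fun u => 1 / (1 + u)) (fun u => 1 / (1 - u)) (Or.inl rfl) (Or.inl rfl) (Or.inr (Or.inr rfl)) (Or.inl rfl)
  obtain ⟨AACC, hAACCd, hAACCi⟩ : ∃ T : IntegralRep 4, T.domain = {t | 0 < t 3 ∧ t 3 < t 2 ∧ t 2 < t 1 ∧ t 1 < t 0 ∧ t 0 < 1} ∧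
      (T.integrand = fun t => 1 / t 0 * (1 / t 1) * (1 / (1 + t 2)) * (1 / (1 + t 3))) :=
    m4_exists_wordRep4 (fun u => 1 / u) (fun u => 1 / u) (fun u => 1 / (1 + u)) (fun u => 1 / (1 + u)) (Or.inl rfl) (Or.inl rfl) (Or.inr (Or.inr rfl)) (Or.inr rfl)
  obtain ⟨ABAB, hABABd, hABABi⟩ : ∃ T : IntegralRep 4, T.domain = {t | 0 < t 3 ∧ t 3 < t 2 ∧ t 2 < t 1 ∧ t 1 < t 0 ∧ t 0 < 1} ∧
      (T.integrand = fun t => 1 / t 0 * (1 / (1 - t 1)) * (1 / t 2) * (1 / (1 - t 3))) :=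
    m4_exists_wordRep4 (fun u => 1 / u) (fun u => 1 / (1 - u)) (fun u => 1 / u) (fun u => 1 / (1 - u)) (Or.inl rfl) (Or.inr (Or.inl rfl)) (Or.inl rfl) (Or.inl rfl)
  obtain ⟨ABAC, hABACd, hABACi⟩ : ∃ T : IntegralRep 4, T.domain = {t | 0 < t 3 ∧ t 3 < t 2 ∧ t 2 < t 1 ∧ t 1 < t 0 ∧ t 0 < 1} ∧
      (T.integrand = fun t => 1 / t 0 * (1 / (1 - t 1)) * (1 / t 2) * (1 / (1 + t 3))) :=
    m4_exists_wordRep4 (fun u => 1 / u) (fun u => 1 / (1 - u)) (fun u => 1 / u) (fun u => 1 / (1 + u)) (Or.inl rfl) (Or.inr (Or.inl rfl)) (Or.inl rfl) (Or.inr rfl)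
  obtain ⟨ACAB, hACABd, hACABi⟩ : ∃ T : IntegralRep 4, T.domain = {t | 0 < t 3 ∧ t 3 < t 2 ∧ t 2 < t 1 ∧ t 1 < t 0 ∧ t 0 < 1} ∧
      (T.integrand = fun t => 1 / t 0 * (1 / (1 + t 1)) * (1 / t 2) * (1 / (1 - t 3))) :=
    m4_exists_wordRep4 (fun u => 1 / u) (fun u => 1 / (1 + u)) (fun u => 1 / u) (fun u => 1 / (1 - u)) (Or.inl rfl) (Or.inr (Or.inr rfl)) (Or.inl rfl) (Or.inl rfl)
  obtain ⟨ACAC, hACACd, hACACi⟩ : ∃ T : IntegralRep 4, T.domain = {t | 0 < t 3 ∧ t 3 < t 2 ∧ t 2 < t 1 ∧ t 1 < t 0 ∧ t 0 < 1} ∧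
      (T.integrand = fun t => 1 / t 0 * (1 / (1 + t 1)) * (1 / t 2) * (1 / (1 + t 3))) :=
    m4_exists_wordRep4 (fun u => 1 / u) (fun u => 1 / (1 + u)) (fun u => 1 / u) (fun u => 1 / (1 + u)) (Or.inl rfl) (Or.inr (Or.inr rfl)) (Or.inl rfl) (Or.inr rfl)
  obtain ⟨CAAB, hCAABd, hCAABi⟩ : ∃ T : IntegralRep 4, T.domain = {t | 0 < t 3 ∧ t 3 < t 2 ∧ t 2 < t 1 ∧ t 1 < t 0 ∧ t 0 < 1} ∧
      (T.integrand = fun t => 1 / (1 + t 0) * (1 / t 1) * (1 / t 2) * (1 / (1 - t 3))) :=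
    m4_exists_wordRep4 (fun u => 1 / (1 + u)) (fun u => 1 / u) (fun u => 1 / u) (fun u => 1 / (1 - u)) (Or.inr rfl) (Or.inl rfl) (Or.inl rfl) (Or.inl rfl)
  obtain ⟨CAAC, hCAACd, hCAACi⟩ : ∃ T : IntegralRep 4, T.domain = {t | 0 < t 3 ∧ t 3 < t 2 ∧ t 2 < t 1 ∧ t 1 < t 0 ∧ t 0 < 1} ∧
      (T.integrand = fun t => 1 / (1 + t 0) * (1 / t 1) * (1 / t 2) * (1 / (1 + t 3))) :=
    m4_exists_wordRep4 (fun u => 1 / (1 + u)) (fun u => 1 / u) (fun u => 1 / u) (fun u => 1 / (1 + u)) (Or.inr rfl) (Or.inl rfl) (Or.inl rfl) (Or.inr rfl)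
  obtain ⟨k1, k2, k3, -, -⟩ := m4_weightFour_mzv_levelTwo C1 hC1d hC1i AB hABd hABi AC hACd hACi AAB hAABd hAABi AAC hAACd hAACi AAAB hAAABd hAAABi AAAC hAAACd hAAACi AABB hAABBd hAABBi AABC hAABCd hAABCi AACB hAACBd hAACBi AACC hAACCd hAACCi ABAB hABABd hABABi ABAC hABACd hABACi ACAB hACABd hACABi ACAC hACACd hACACi CAAB hCAABd hCAABi CAAC hCAACd hCAACi
  exact ⟨AB, AAAB, AABB, ABAB, hABd, hABi, hAAABd, hAAABi, hAABBd, hAABBi, hABABd, hABABi, k1, k2, k3⟩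

/-- Bounds on the open unit box used by the pull-back identities. [folklore] -/
theorem m4z_box_facts {x : Fin 4 → ℝ} (hx : ∀ i, x i ∈ Set.Ioo (0:ℝ) 1) :
    0 < x 0 ∧ 0 < x 1 ∧ 0 < x 2 ∧ 0 < x 3 ∧ x 0 * x 1 < 1 ∧ x 0 * x 1 * x 2 < 1 ∧
      x 0 * x 1 * x 2 * x 3 < 1 := by
  have h01 : x 0 * x 1 < 1 := mul_lt_one_of_nonneg_of_lt_one_left (hx 0).1.le (hx 0).2 (hx 1).2.le
  have h012 : x 0 * x 1 * x 2 < 1 :=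
    mul_lt_one_of_nonneg_of_lt_one_left (mul_pos (hx 0).1 (hx 1).1).le h01 (hx 2).2.le
  exact ⟨(hx 0).1, (hx 1).1, (hx 2).1, (hx 3).1, h01, h012, mul_lt_one_of_nonneg_of_lt_one_left
    (mul_pos (mul_pos (hx 0).1 (hx 1).1) (hx 2).1).le h012 (hx 3).2.le⟩

/-- Bounds on the decreasing simplex `Δ₄`. [folklore] -/
theorem m4z_simplex_facts {t : Fin 4 → ℝ}
    (ht : t ∈ {t : Fin 4 → ℝ | 0 < t 3 ∧ t 3 < t 2 ∧ t 2 < t 1 ∧ t 1 < t 0 ∧ t 0 < 1}) :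
    0 < t 0 ∧ 0 < t 1 ∧ 0 < 1 - t 1 ∧ 0 < t 2 ∧ 0 < 1 - t 2 ∧ 0 < 1 - t 3 := by
  obtain ⟨h3, h32, h21, h10, h0⟩ := ht
  exact ⟨by linarith, by linarith, by linarith, by linarith, by linarith, by linarith⟩

/-- **A box charts onto a multiple of a word.** If `W` is a word carrier on `Δ₄` with integrand
`g` and `r = [□⁴, ≡ k·g(Cx)·x₀³x₁²x₂]`, then `[r] − k•[W] ∈ KZ.relations` (cubical chart onto
`W.constMul k`, then the scaling). [cite: KontsevichZagier2001, §1.2 rules (1), (2)] -/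
theorem m4z_box_sub_nsmul_word (k : ℕ) (g : (Fin 4 → ℝ) → ℝ) (r W : IntegralRep 4)
    (hrd : r.domain = {x | ∀ i, x i ∈ Set.Ioo (0:ℝ) 1}) (hWd : W.domain = {t | 0 < t 3 ∧ t 3 < t 2 ∧ t 2 < t 1 ∧ t 1 < t 0 ∧ t 0 < 1}) (hWi : W.integrand = g)
    (hri : EqOn r.integrand (fun x => (k:ℝ) *
      (g ![x 0, x 0 * x 1, x 0 * x 1 * x 2, x 0 * x 1 * x 2 * x 3] * (x 0 ^ 3 * x 1 ^ 2 * x 2)))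
      r.domain) :
    of r - k • of W ∈ relations := by
  have c1 : of r - of (W.constMul (k:ℝ) (isAlgebraic_nat k)) ∈ relations := by
    refine m4_box_sub_simplex4.1 (fun t => (k:ℝ) * g t) r _ hrd
      (by rw [IntegralRep.domain_constMul, hWd])
      (fun t _ => by rw [IntegralRep.integrand_constMul, hWi]) fun x hx => ?_
    rw [hri hx]
    ring
  have c2 := IntegralRep.of_constMul_nat_sub_nsmul_mem_relations W k
  have e : of r - k • of W = (of r - of (W.constMul (k:ℝ) (isAlgebraic_nat k))) +
      (of (W.constMul (k:ℝ) (isAlgebraic_nat k)) - k • of W) := by abel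
  rw [e]
  exact relations.add_mem c1 c2

/-- **`ζ(3,1) + ζ(4) = (5/4)ζ(4)` as a box pair** (lead seat c9, line `SketchIdeator1`, layer
`M4`): `4·[□⁴, 1/((1 − x₀x₁x₂)(1 − x₀x₁x₂x₃))] ∼ 5·[□⁴, 1/(1 − x₀x₁x₂x₃)]`, through level two.
[cite: KontsevichZagier2001, §1.2 rules (1), (2)] -/
theorem m4_zetaThreeOne_box :
    ∀ (r r' : IntegralRep 4), r.domain = {x | ∀ i, x i ∈ Set.Ioo (0:ℝ) 1} →
      EqOn r.integrand (fun x => 4 / ((1 - x 0 * x 1 * x 2) * (1 - x 0 * x 1 * x 2 * x 3))) r.domain →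
      r'.domain = {x | ∀ i, x i ∈ Set.Ioo (0:ℝ) 1} →
      EqOn r'.integrand (fun x => 5 / (1 - x 0 * x 1 * x 2 * x 3)) r'.domain →
      Equivalent r r' := by
  intro r r' hrd hri hr'd hr'i
  obtain ⟨AB, AAAB, AABB, ABAB, -, -, hAAABd, hAAABi, hAABBd, hAABBi, -, -, k1, -, -⟩ :=
    m4z_exists_carriers
  -- the left side charts onto `4·V`, `V = [Δ₄, 1/(t₀t₁t₂(1−t₂)(1−t₃))] = AAAB + AABB`
  have hIa : IntegrableOn (fun t : Fin 4 → ℝ => 1 / t 0 * (1 / t 1) * (1 / t 2) * (1 / (1 - t 3)))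
      {t : Fin 4 → ℝ | 0 < t 3 ∧ t 3 < t 2 ∧ t 2 < t 1 ∧ t 1 < t 0 ∧ t 0 < 1} := by
    have h := AAAB.integrableOn; rw [hAAABd, hAAABi] at h; exact h
  have hIb : IntegrableOn (fun t : Fin 4 → ℝ => 1 / t 0 * (1 / t 1) * (1 / (1 - t 2)) * (1 / (1 - t 3)))
      {t : Fin 4 → ℝ | 0 < t 3 ∧ t 3 < t 2 ∧ t 2 < t 1 ∧ t 1 < t 0 ∧ t 0 < 1} := by
    have h := AABB.integrableOn; rw [hAABBd, hAABBi] at h; exact h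
  have hFG : ∀ t ∈ {t : Fin 4 → ℝ | 0 < t 3 ∧ t 3 < t 2 ∧ t 2 < t 1 ∧ t 1 < t 0 ∧ t 0 < 1},
      1 / (t 0 * t 1 * t 2 * (1 - t 2) * (1 - t 3)) =
        1 / t 0 * (1 / t 1) * (1 / t 2) * (1 / (1 - t 3)) +
          1 / t 0 * (1 / t 1) * (1 / (1 - t 2)) * (1 / (1 - t 3)) := fun t ht => by
    obtain ⟨h0, h1, h11, h2, h21, h31⟩ := m4z_simplex_facts ht
    field_simp
    ring
  obtain ⟨V, hVd, hVi⟩ : ∃ T : IntegralRep 4, T.domain = {t | 0 < t 3 ∧ t 3 < t 2 ∧ t 2 < t 1 ∧ t 1 < t 0 ∧ t 0 < 1} ∧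
      T.integrand = fun t => 1 / (t 0 * t 1 * t 2 * (1 - t 2) * (1 - t 3)) := by
    have hq : ∀ t ∈ {t : Fin 4 → ℝ | 0 < t 3 ∧ t 3 < t 2 ∧ t 2 < t 1 ∧ t 1 < t 0 ∧ t 0 < 1},
        (MvPolynomial.aeval t (MvPolynomial.X 0 * MvPolynomial.X 1 * MvPolynomial.X 2 *
          (1 - MvPolynomial.X 2) * (1 - MvPolynomial.X 3) : MvPolynomial (Fin 4) ℚ) : ℝ) ≠ 0 := by
      intro t ht
      obtain ⟨h0, h1, h11, h2, h21, h31⟩ := m4z_simplex_facts ht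
      simp only [map_mul, map_sub, map_one, MvPolynomial.aeval_X]
      positivity
    refine m4s_exists_rep_of_abs_le ((isSemialgebraicFunOn_aeval_div_aeval
      m4s_isSemialgebraic_simplex4 1 _ hq).congr fun t _ => by
        simp only [map_mul, map_sub, map_one, MvPolynomial.aeval_X]) ?_ (hIa.add hIb)
      fun t ht => ?_
    · exact continuousOn_const.div (by fun_prop) fun t ht => by
        obtain ⟨h0, h1, h11, h2, h21, h31⟩ := m4z_simplex_facts ht
        positivity
    · obtain ⟨h0, h1, h11, h2, h21, h31⟩ := m4z_simplex_facts ht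
      rw [Pi.add_apply, hFG t ht, abs_of_pos (by positivity)]
  have c1 : of r - (4:ℕ) • of V ∈ relations := by
    refine m4z_box_sub_nsmul_word 4 _ r V hrd hVd hVi fun x hx => ?_
    rw [hrd] at hx
    obtain ⟨h0, h1, h2, h3, -, h012, hP⟩ := m4z_box_facts hx
    rw [hri (hrd ▸ hx)]
    simp only [Matrix.cons_val_zero, Matrix.cons_val_one, Matrix.head_cons, Matrix.cons_val_two,
      Matrix.tail_cons, Matrix.cons_val_three]
    have h012' : 1 - x 0 * x 1 * x 2 ≠ 0 := by linarith
    have hP' : 1 - x 0 * x 1 * x 2 * x 3 ≠ 0 := by linarith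
    push_cast
    field_simp
  have c2 : of V - ((1:ℤ) • of AAAB + (1:ℤ) • of AABB) ∈ relations := by
    have h := aff_orbit_of_sub_sum_zsmul_mem_relations (Finset.univ : Finset (Fin 2))
      ![AAAB, AABB] ![1, 1] V (fun i _ => by
        fin_cases i
        · exact hAAABd.trans hVd.symm
        · exact hAABBd.trans hVd.symm) fun t ht => ?_
    · simpa [Fin.sum_univ_two] using h
    rw [hVi]
    simp only [Fin.sum_univ_two, Matrix.cons_val_zero, Matrix.cons_val_one, hAAABi, hAABBi]
    push_cast
    rw [one_mul, one_mul]
    exact hFG t (hVd ▸ ht)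
  -- the right side charts onto `5·AAAB`
  have c3 : of r' - (5:ℕ) • of AAAB ∈ relations := by
    refine m4z_box_sub_nsmul_word 5 _ r' AAAB hr'd hAAABd hAAABi fun x hx => ?_
    rw [hr'd] at hx
    obtain ⟨h0, h1, h2, h3, -, -, hP⟩ := m4z_box_facts hx
    rw [hr'i (hr'd ▸ hx)]
    simp only [Matrix.cons_val_zero, Matrix.cons_val_one, Matrix.head_cons, Matrix.cons_val_two,
      Matrix.tail_cons, Matrix.cons_val_three]
    have hP' : 1 - x 0 * x 1 * x 2 * x 3 ≠ 0 := by linarith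
    push_cast
    field_simp
  show of r - of r' ∈ relations
  have e : of r - of r' = (of r - (4:ℕ) • of V) + (4:ℕ) • (of V - ((1:ℤ) • of AAAB + (1:ℤ) • of AABB))
      + ((4:ℤ) • of AABB - of AAAB) - (of r' - (5:ℕ) • of AAAB) := by
    simp only [one_smul, smul_sub, smul_add]
    abel
  rw [e]
  exact relations.sub_mem (relations.add_mem (relations.add_mem c1 (relations.nsmul_mem c2 _)) k1) c3

/-- **`ζ(2,2) + ζ(4) = (7/4)ζ(4)` as a box pair** (lead seat c9, line `SketchIdeator1`, layer
`M4`): `7·[□⁴, 1/(1 − x₀x₁x₂x₃)] ∼ 4·[□⁴, 1/((1 − x₀x₁)(1 − x₀x₁x₂x₃))]`, through level two.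
[cite: KontsevichZagier2001, §1.2 rules (1), (2)] -/
theorem m4_zetaTwoTwo_box :
    ∀ (r r' : IntegralRep 4), r.domain = {x | ∀ i, x i ∈ Set.Ioo (0:ℝ) 1} →
      EqOn r.integrand (fun x => 7 / (1 - x 0 * x 1 * x 2 * x 3)) r.domain →
      r'.domain = {x | ∀ i, x i ∈ Set.Ioo (0:ℝ) 1} →
      EqOn r'.integrand (fun x => 4 / ((1 - x 0 * x 1) * (1 - x 0 * x 1 * x 2 * x 3))) r'.domain →
      Equivalent r r' := by
  intro r r' hrd hri hr'd hr'i
  obtain ⟨AB, AAAB, AABB, ABAB, -, -, hAAABd, hAAABi, -, -, hABABd, hABABi, -, k2, -⟩ :=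
    m4z_exists_carriers
  have hIa : IntegrableOn (fun t : Fin 4 → ℝ => 1 / t 0 * (1 / t 1) * (1 / t 2) * (1 / (1 - t 3)))
      {t : Fin 4 → ℝ | 0 < t 3 ∧ t 3 < t 2 ∧ t 2 < t 1 ∧ t 1 < t 0 ∧ t 0 < 1} := by
    have h := AAAB.integrableOn; rw [hAAABd, hAAABi] at h; exact h
  have hIb : IntegrableOn (fun t : Fin 4 → ℝ => 1 / t 0 * (1 / (1 - t 1)) * (1 / t 2) * (1 / (1 - t 3)))
      {t : Fin 4 → ℝ | 0 < t 3 ∧ t 3 < t 2 ∧ t 2 < t 1 ∧ t 1 < t 0 ∧ t 0 < 1} := by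
    have h := ABAB.integrableOn; rw [hABABd, hABABi] at h; exact h
  have hFG : ∀ t ∈ {t : Fin 4 → ℝ | 0 < t 3 ∧ t 3 < t 2 ∧ t 2 < t 1 ∧ t 1 < t 0 ∧ t 0 < 1},
      1 / (t 0 * t 1 * (1 - t 1) * t 2 * (1 - t 3)) =
        1 / t 0 * (1 / t 1) * (1 / t 2) * (1 / (1 - t 3)) +
          1 / t 0 * (1 / (1 - t 1)) * (1 / t 2) * (1 / (1 - t 3)) := fun t ht => by
    obtain ⟨h0, h1, h11, h2, h21, h31⟩ := m4z_simplex_facts ht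
    field_simp
    ring
  obtain ⟨V, hVd, hVi⟩ : ∃ T : IntegralRep 4, T.domain = {t | 0 < t 3 ∧ t 3 < t 2 ∧ t 2 < t 1 ∧ t 1 < t 0 ∧ t 0 < 1} ∧
      T.integrand = fun t => 1 / (t 0 * t 1 * (1 - t 1) * t 2 * (1 - t 3)) := by
    have hq : ∀ t ∈ {t : Fin 4 → ℝ | 0 < t 3 ∧ t 3 < t 2 ∧ t 2 < t 1 ∧ t 1 < t 0 ∧ t 0 < 1},
        (MvPolynomial.aeval t (MvPolynomial.X 0 * MvPolynomial.X 1 * (1 - MvPolynomial.X 1) *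
          MvPolynomial.X 2 * (1 - MvPolynomial.X 3) : MvPolynomial (Fin 4) ℚ) : ℝ) ≠ 0 := by
      intro t ht
      obtain ⟨h0, h1, h11, h2, h21, h31⟩ := m4z_simplex_facts ht
      simp only [map_mul, map_sub, map_one, MvPolynomial.aeval_X]
      positivity
    refine m4s_exists_rep_of_abs_le ((isSemialgebraicFunOn_aeval_div_aeval
      m4s_isSemialgebraic_simplex4 1 _ hq).congr fun t _ => by
        simp only [map_mul, map_sub, map_one, MvPolynomial.aeval_X]) ?_ (hIa.add hIb)
      fun t ht => ?_
    · exact continuousOn_const.div (by fun_prop) fun t ht => by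
        obtain ⟨h0, h1, h11, h2, h21, h31⟩ := m4z_simplex_facts ht
        positivity
    · obtain ⟨h0, h1, h11, h2, h21, h31⟩ := m4z_simplex_facts ht
      rw [Pi.add_apply, hFG t ht, abs_of_pos (by positivity)]
  have c1 : of r' - (4:ℕ) • of V ∈ relations := by
    refine m4z_box_sub_nsmul_word 4 _ r' V hr'd hVd hVi fun x hx => ?_
    rw [hr'd] at hx
    obtain ⟨h0, h1, h2, h3, h01, -, hP⟩ := m4z_box_facts hx
    rw [hr'i (hr'd ▸ hx)]
    simp only [Matrix.cons_val_zero, Matrix.cons_val_one, Matrix.head_cons, Matrix.cons_val_two,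
      Matrix.tail_cons, Matrix.cons_val_three]
    have h01' : 1 - x 0 * x 1 ≠ 0 := by linarith
    have hP' : 1 - x 0 * x 1 * x 2 * x 3 ≠ 0 := by linarith
    push_cast
    field_simp
  have c2 : of V - ((1:ℤ) • of AAAB + (1:ℤ) • of ABAB) ∈ relations := by
    have h := aff_orbit_of_sub_sum_zsmul_mem_relations (Finset.univ : Finset (Fin 2))
      ![AAAB, ABAB] ![1, 1] V (fun i _ => by
        fin_cases i
        · exact hAAABd.trans hVd.symm
        · exact hABABd.trans hVd.symm) fun t ht => ?_
    · simpa [Fin.sum_univ_two] using h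
    rw [hVi]
    simp only [Fin.sum_univ_two, Matrix.cons_val_zero, Matrix.cons_val_one, hAAABi, hABABi]
    push_cast
    rw [one_mul, one_mul]
    exact hFG t (hVd ▸ ht)
  have c3 : of r - (7:ℕ) • of AAAB ∈ relations := by
    refine m4z_box_sub_nsmul_word 7 _ r AAAB hrd hAAABd hAAABi fun x hx => ?_
    rw [hrd] at hx
    obtain ⟨h0, h1, h2, h3, -, -, hP⟩ := m4z_box_facts hx
    rw [hri (hrd ▸ hx)]
    simp only [Matrix.cons_val_zero, Matrix.cons_val_one, Matrix.head_cons, Matrix.cons_val_two,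
      Matrix.tail_cons, Matrix.cons_val_three]
    have hP' : 1 - x 0 * x 1 * x 2 * x 3 ≠ 0 := by linarith
    push_cast
    field_simp
  show of r - of r' ∈ relations
  have e : of r - of r' = (of r - (7:ℕ) • of AAAB) - ((4:ℤ) • of ABAB - (3:ℤ) • of AAAB)
      - (4:ℕ) • (of V - ((1:ℤ) • of AAAB + (1:ℤ) • of ABAB)) - (of r' - (4:ℕ) • of V) := by
    simp only [one_smul, smul_sub, smul_add]
    abel
  rw [e]
  exact relations.sub_mem (relations.sub_mem (relations.sub_mem c3 k2) (relations.nsmul_mem c2 _)) c1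

/-- **`ζ(2)² = (5/2)ζ(4)` as a box pair** (lead seat c9, line `SketchIdeator1`, layer `M4`):
`2·[□⁴, 1/((1 − x₀x₁)(1 − x₂x₃))] ∼ 5·[□⁴, 1/(1 − x₀x₁x₂x₃)]`, through level two and the product
ideal. [cite: KontsevichZagier2001, §1.2 rules (1), (2); §4.1] -/
theorem m4_zetaTwoSquared_box :
    ∀ (r r' : IntegralRep 4), r.domain = {x | ∀ i, x i ∈ Set.Ioo (0:ℝ) 1} →
      EqOn r.integrand (fun x => 2 / ((1 - x 0 * x 1) * (1 - x 2 * x 3))) r.domain →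
      r'.domain = {x | ∀ i, x i ∈ Set.Ioo (0:ℝ) 1} →
      EqOn r'.integrand (fun x => 5 / (1 - x 0 * x 1 * x 2 * x 3)) r'.domain →
      Equivalent r r' := by
  intro r r' hrd hri hr'd hr'i
  obtain ⟨AB, AAAB, AABB, ABAB, hABd, hABi, hAAABd, hAAABi, -, -, -, -, -, -, k3⟩ :=
    m4z_exists_carriers
  -- the dilogarithm box `Bm = [□², 1/(1 − xy)] ∼ AB`, and `r ≡ (2·Bm) × Bm`
  obtain ⟨Bm, hBmd, hBmi⟩ := exists_dilogBox isAlgebraic_one (Or.inl le_rfl)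
  have hBA : of Bm - of AB ∈ relations :=
    bss_box_sub_simplex_of_one_le (a := 1) (z := 1) isAlgebraic_one le_rfl (one_mul 1) Bm AB hBmd
      (hBmi ▸ fun _ _ => rfl) hABd fun t _ => by rw [hABi]; exact one_div_mul_one_div _ _
  set R : IntegralRep 2 := Bm.constMul ((2:ℕ):ℝ) (isAlgebraic_nat 2) with hR
  have c1 : of r - of (R.prod Bm) ∈ relations := by
    refine m4b_of_sub_of_prod_mem_relations R Bm (by rw [hR, IntegralRep.domain_constMul, hBmd])
      hBmd r hrd fun x hx => ?_
    rw [hri hx, hR, IntegralRep.integrand_constMul, hBmi]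
    show 2 / ((1 - x 0 * x 1) * (1 - x 2 * x 3)) = ((2:ℕ):ℝ) * (1 / (1 - x 0 * x 1)) * (1 / (1 - x 2 * x 3))
    push_cast
    rw [mul_one_div, mul_one_div, div_div]
  have c2 : of (R.prod Bm) - (2:ℕ) • of (Bm.prod Bm) ∈ relations := by
    have h := mul_mem_relations_right_holds _ (of Bm)
      (IntegralRep.of_constMul_nat_sub_nsmul_mem_relations Bm 2)
    rwa [sub_mul, smul_mul_assoc, of_mul_of, of_mul_of] at h
  have c3 : of (Bm.prod Bm) - of (AB.prod AB) ∈ relations := Equivalent.prod hBA hBA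
  -- the right side charts onto `5·AAAB`
  have c4 : of r' - (5:ℕ) • of AAAB ∈ relations := by
    refine m4z_box_sub_nsmul_word 5 _ r' AAAB hr'd hAAABd hAAABi fun x hx => ?_
    rw [hr'd] at hx
    obtain ⟨h0, h1, h2, h3, -, -, hP⟩ := m4z_box_facts hx
    rw [hr'i (hr'd ▸ hx)]
    simp only [Matrix.cons_val_zero, Matrix.cons_val_one, Matrix.head_cons, Matrix.cons_val_two,
      Matrix.tail_cons, Matrix.cons_val_three]
    have hP' : 1 - x 0 * x 1 * x 2 * x 3 ≠ 0 := by linarith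
    push_cast
    field_simp
  show of r - of r' ∈ relations
  have e : of r - of r' = (of r - of (R.prod Bm)) + (of (R.prod Bm) - (2:ℕ) • of (Bm.prod Bm))
      + (2:ℕ) • (of (Bm.prod Bm) - of (AB.prod AB)) + ((2:ℤ) • of (AB.prod AB) - (5:ℤ) • of AAAB)
      - (of r' - (5:ℕ) • of AAAB) := by
    simp only [smul_sub]
    abel
  rw [e]
  exact relations.sub_mem (relations.add_mem (relations.add_mem (relations.add_mem c1 c2)
    (relations.nsmul_mem c3 _)) k3) c4

end Summit.KontsevichZagierPeriods.HurwitzMicroSectors.NormalFormPrinciple.PiBox.M3
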